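import Mathlib.FieldTheory.Galois.Profinite
import Literature.IUT.HodgeTheaters.InitialThetaDataLocalGroupsOpenProofs
import HarnessLib

/-!
# [IUTchI] Definition 3.1 (e): the §1 data of the local core `C_v̲ := C_K ×_K K_v̲` — a `PuncturedEllipticData`
# over `Gal(K̄_v̲/K_v̲)` by base change (the cartesian diagrams `X̲_v̲ → X_v̲`, `C_v̲`, cusps `ε̲_v̲`)

S. Mochizuki, *Inter-universal Teichmüller theory I*, §3, Def. 3.1 (e), (f) (kurims manuscript, May 2020, pp. 62–63)
[claim: Mochizuki2012, status: disputed]: "for each `v̲ ∈ V(K)`, we shall use the subscript `v̲` to denote the result of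
base-changing hyperbolic orbicurves over `F` or `K` to `K_v̲`. Thus … natural cartesian diagrams `X̲_v̲ → X_v̲ → X_v`,
… `Δ_X → Π_{X̲_v̲} → Π_{X_v}` … natural outer surjections onto the decomposition group `G_v ⊆ G_K`"; (f): "If `v ∈ V̲`,
then let us write `ε̲_v` for the cusp of `C̲_v` determined by `ε̲`."
For `D : InitialThetaData F K Fbar E l P` (the REAL Def. 3.1, abc-iut-L5-t2), a `K`-field `k` (`= K_v̲`), a Galois
extension `Ω ⊇ k` (`= K̄_v̲`) and a `K`-embedding `ι : F̄ → Ω`, this file CONSTRUCTS the LOCAL version of abc-iut-L5-t1's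
§1 datum `PuncturedEllipticData` ([IUTchI] §1 p. 37) at `v̲`, with no hypothesis beyond the standing instances:
* `D.extLoc k ι : FundamentalExtension` — `Π_{C_v̲} := Π_{C_K} ×_{G_F} Gal(Ω/k) ↠ Gal(Ω/k)` (`InitialThetaData.PiLoc D.PiCK
  (localToGF F k ι)`, PROFINITE: `Π_{C_K}` is open hence closed, `Gal(Ω/k)` profinite; surjective by `Π_{X̲_K} ↠ G_K`);
* **`D.peLoc k ι : PuncturedEllipticData`** — `Π_{X_v̲}`, `Π_{C̲_v̲}` := preimages of `Π_{X_F}` (= of `Π_{X_K}`), `Π_{C̲_K}`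
  under `Π_{C_v̲} → Π_{C_F}`; the SAME cusps with LOCAL decomposition groups `D_{x,v̲} :=` preimage of `embK(D_x)`; `ε⁰, ε′,
  ε″, 2ε̲` and `l` unchanged; ALL standing conditions of §1 PROVED for the base change: openness, **`[Π_{C_v̲} : Π_{X_v̲}]
  = 2`** (`index_piXLoc`: `Π_{X_F}` normal of index `2`; `Δ_C` lies in the decomposition subgroup, not in `Π_{X_F}`),
  `Π_{X_v̲}, Π_{C̲_v̲}, D_{2ε,v̲} ↠ Gal(Ω/k)`, and condition (∗) TRANSPORTED from the `K`-level datum along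
  `Δ_{C_K} → Π_{C_v̲}`, `y ↦ (embK y, 1)` (`star_transport`, `starLoc`).
Consumers: the LOCAL half of the §4–§6 label/decomposition-group bindings (abc-iut-L5-t4 KIT-INSTANCE-SPEC P5; GAP
G-L5t4g3-2). The comparison of `(D.peLoc k ι).piXarrow` (Def. 1.1 run locally) with the base change `D.PiLoc D.PiXarrow`
of print's `Π_v̲ := Π_{X̲→_v̲}` is left to a sequel. Nothing of the series is asserted; no side is taken.
-/

noncomputable section

namespace Literature.IUT.HodgeTheaters

open Topology

universe u v w

namespace InitialThetaData

section Topology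

variable {F : Type u} {K : Type v} {Fbar : Type w} [Field F] [NumberField F] [Field K] [NumberField K]
  [Algebra F K] [Field Fbar] [Algebra F Fbar] [Algebra K Fbar] [Algebra.IsIntegral F Fbar]
  {E : WeierstrassCurve F} [E.IsElliptic] {l : ℕ} {Pb : BadPlacePredicates K}
  (D : InitialThetaData F K Fbar E l Pb)

omit [Algebra.IsIntegral F Fbar] in
include D in
/-- `F̄` is integral over `F` (an algebraic closure): the instance hypothesis `[Algebra.IsIntegral F Fbar]` of this
file (it makes the Krull topology on `G_F` Hausdorff), discharged from the datum. [claim: Mochizuki2012, status: disputed] -/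
theorem isIntegral_F : Algebra.IsIntegral F Fbar := by
  haveI := D.isAlgClosure
  haveI : Algebra.IsAlgebraic F Fbar := IsAlgClosure.isAlgebraic
  exact Algebra.isAlgebraic_iff_isIntegral.mp inferInstance

/-- A base change `Π_{(−)_v̲} = Π_{(−)} ×_{G_F} Γ` of a CLOSED subgroup along a continuous `ρ` is closed in
`Π_{C_F} × Γ` (`G_F` is Hausdorff; the open-subgroup case over `Fbar : Type` is abc-iut-w5-d096's
`InitialThetaData.isClosed_PiLoc`, `InitialThetaDataLocalSlim.lean`). [claim: Mochizuki2012, status: disputed] -/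
theorem isClosed_PiLoc_of_isClosed {Γ : Type*} [Group Γ] [TopologicalSpace Γ] (H : Subgroup D.PiC)
    (ρ : Γ →* (Fbar ≃ₐ[F] Fbar)) (hH : IsClosed (H : Set D.PiC)) (hρ : Continuous ρ) :
    IsClosed (D.PiLoc H ρ : Set (D.PiC × Γ)) := by
  change IsClosed {z : D.PiC × Γ | z.1 ∈ H ∧ D.augGF z.1 = ρ z.2}
  exact (hH.preimage continuous_fst).inter
    (isClosed_eq (D.continuous_augGF.comp continuous_fst) (hρ.comp continuous_snd))

end Topology

section PeLoc

variable {F : Type u} {K : Type v} {Fbar : Type w} [Field F] [NumberField F] [Field K] [NumberField K]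
  [Algebra F K] [Field Fbar] [Algebra F Fbar] [Algebra K Fbar] [IsScalarTower F K Fbar] [Normal K Fbar]
  [Algebra.IsIntegral F Fbar]
  {E : WeierstrassCurve F} [E.IsElliptic] {l : ℕ} {Pb : BadPlacePredicates K}
  (D : InitialThetaData F K Fbar E l Pb)
  {Ω : Type w} [Field Ω] [Algebra K Ω]
  (k : Type w) [Field k] [Algebra K k] [Algebra k Ω] [IsScalarTower K k Ω] [IsGalois k Ω] (ι : Fbar →ₐ[K] Ω)

/-- `Π_{C_v̲} := Π_{C_K} ×_{G_F} Gal(Ω/k)` is COMPACT (`Π_{C_K}` is open hence closed in the profinite `Π_{C_F}`,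
`Gal(Ω/k)` is profinite for `Ω/k` Galois). [claim: Mochizuki2012, status: disputed] -/
theorem compactSpace_PiLoc_PiCK : CompactSpace (D.PiLoc D.PiCK (localToGF F k ι)) :=
  isCompact_iff_compactSpace.mp
    (D.isClosed_PiLoc_of_isClosed D.PiCK (localToGF F k ι) (D.PiCK.isClosed_of_isOpen D.isOpen_PiCK)
      (continuous_localToGF F k ι)).isCompact

/-- **`Π_{C_v̲} ↠ Gal(Ω/k)` as an extension of profinite groups** (Def. 3.1 (e): the base change
`C_v̲ := C_K ×_K K_v̲`, `Π_{C_v̲} := Π_{C_K} ×_{G_F} Gal(Ω/k)`; the surjection by `Π_{X̲_K} ↠ G_K`).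
[claim: Mochizuki2012, status: disputed] -/
def extLoc : Literature.AnabelianGeometry.AbsoluteAnabelian.FundamentalExtension.{w} :=
  haveI := D.compactSpace_PiLoc_PiCK k ι
  { arith := ProfiniteGrp.of (D.PiLoc D.PiCK (localToGF F k ι))
    gal := ProfiniteGrp.of (Ω ≃ₐ[k] Ω)
    aug := { D.augLoc D.PiCK (localToGF F k ι) with
      continuous_toFun := D.continuous_augLoc D.PiCK (localToGF F k ι) }
    aug_surjective := D.augLoc_localToGF_surjective_of_PiXund_le k ι D.PiXund_le_PiCK }

/-- The augmentation of `extLoc` IS `augLoc` (the second projection). [claim: Mochizuki2012, status: disputed] -/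
theorem extLoc_aug_apply (z : D.PiLoc D.PiCK (localToGF F k ι)) :
    (D.extLoc k ι).aug z = D.augLoc D.PiCK (localToGF F k ι) z := rfl

/-! ### The ingredients of the local §1 datum -/

omit [Algebra.IsIntegral F Fbar] [IsGalois k Ω] in
/-- `Δ_C` lies in the decomposition subgroup `Π_{C_K} ∩ augGF⁻¹(G_v̲)` = the image of `Π_{C_v̲} → Π_{C_F}`.
[claim: Mochizuki2012, status: disputed] -/
theorem deltaC_le_range_fstLoc : D.DeltaC ≤ (D.fstLoc D.PiCK (localToGF F k ι)).range := by
  intro x hx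
  have h1 : D.augGF x = 1 := (D.augGF_eq_one_iff x).mpr hx
  rw [range_fstLoc]
  refine Subgroup.mem_inf.mpr ⟨?_, ?_⟩
  · change x ∈ D.geom.embK.range
    rw [D.geom.embK_range, Subgroup.mem_comap]
    change D.augGF x ∈ galoisSubgroupOf F K Fbar
    rw [h1]
    exact Subgroup.one_mem _
  · rw [Subgroup.mem_comap, h1]
    exact Subgroup.one_mem _

omit [IsScalarTower F K Fbar] [Normal K Fbar] [Algebra.IsIntegral F Fbar] in
/-- `Δ_C ⊄ Π_{X_F}` (`Π_{X_F}` has index `2` and surjects onto `G_F`). [claim: Mochizuki2012, status: disputed] -/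
theorem not_deltaC_le_PiX : ¬ D.DeltaC ≤ D.geom.PiX := by
  intro h
  have htop : D.geom.PiX = ⊤ := by
    rw [eq_top_iff]
    intro x _
    have hx : D.geom.extF.aug x ∈ D.geom.PiX.map D.geom.extF.aug.toMonoidHom := by
      rw [D.geom.aug_PiX]; exact Subgroup.mem_top _
    obtain ⟨p, hp, hpx⟩ := hx
    have hk : x * p⁻¹ ∈ D.DeltaC := by
      change x * p⁻¹ ∈ D.geom.extF.geom
      rw [Literature.AnabelianGeometry.AbsoluteAnabelian.FundamentalExtension.mem_geom, map_mul, map_inv]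
      change D.geom.extF.aug x * (D.geom.extF.aug.toMonoidHom p)⁻¹ = 1
      rw [hpx, mul_inv_cancel]
    have := Subgroup.mul_mem _ (h hk) hp
    rwa [inv_mul_cancel_right] at this
  have h2 := D.geom.PiX_index
  rw [htop, Subgroup.index_top] at h2
  exact absurd h2 (by norm_num)

omit [Algebra.IsIntegral F Fbar] [IsGalois k Ω] in
/-- **`[Π_{C_v̲} : Π_{X_v̲}] = 2`** for `Π_{X_v̲} :=` the preimage of `Π_{X_F}` under `Π_{C_v̲} → Π_{C_F}`: the index is
the relative index of the normal index-`2` subgroup `Π_{X_F}` in the decomposition subgroup, which contains `Δ_C ⊄ Π_{X_F}`.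
[claim: Mochizuki2012, status: disputed] -/
theorem index_piXLoc : (D.geom.PiX.comap (D.fstLoc D.PiCK (localToGF F k ι))).index = 2 := by
  haveI := D.geom.PiX_normal
  rw [Subgroup.index_comap]
  have hdvd : D.geom.PiX.relIndex (D.fstLoc D.PiCK (localToGF F k ι)).range ∣ 2 := by
    rw [← D.geom.PiX_index]
    exact Subgroup.relIndex_dvd_index_of_normal _ _
  have hne : D.geom.PiX.relIndex (D.fstLoc D.PiCK (localToGF F k ι)).range ≠ 1 := by
    rw [Ne, Subgroup.relIndex_eq_one]
    exact fun h => D.not_deltaC_le_PiX ((D.deltaC_le_range_fstLoc k ι).trans h)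
  rcases (Nat.dvd_prime Nat.prime_two).mp hdvd with h | h
  · exact absurd h hne
  · exact h

omit [IsScalarTower F K Fbar] [Normal K Fbar] [Algebra.IsIntegral F Fbar] in
/-- `embK y ∈ Δ_C ↔ y ∈ Δ_{C_K}` (compatibility of the augmentations, `galKIso` injective).
[claim: Mochizuki2012, status: disputed] -/
theorem embK_mem_deltaC_iff (y : D.geom.pe.PiC) : D.geom.embK y ∈ D.DeltaC ↔ y ∈ D.geom.pe.E.geom := by
  rw [← D.augGF_eq_one_iff, augGF_apply, D.geom.aug_compat,
    Literature.AnabelianGeometry.AbsoluteAnabelian.FundamentalExtension.mem_geom]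
  constructor
  · intro h
    have h' : D.geom.galKIso (D.geom.pe.E.aug y) = 1 := Subtype.ext h
    exact (map_eq_one_iff _ D.geom.galKIso.injective).mp h'
  · intro h
    rw [h, map_one]
    rfl

omit [IsScalarTower F K Fbar] [Normal K Fbar] [Algebra.IsIntegral F Fbar] in
/-- `embK y ∈ Π_{X_F} ↔ y ∈ Π_X` (`Π_{X_K} = Π_{X_F} ∩ Π_{C_K}` is the image of `Π_X`, field `embK_PiX`).
[claim: Mochizuki2012, status: disputed] -/
theorem embK_mem_PiX_iff (y : D.geom.pe.PiC) : D.geom.embK y ∈ D.geom.PiX ↔ y ∈ D.geom.pe.PiX := by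
  constructor
  · intro h
    have h2 : D.geom.embK y ∈ D.geom.pe.PiX.map D.geom.embK := by
      rw [D.geom.embK_PiX]; exact ⟨h, ⟨y, rfl⟩⟩
    obtain ⟨y', hy', he⟩ := h2
    rwa [← D.geom.embK_injective he]
  · intro h
    have : D.geom.embK y ∈ D.geom.pe.PiX.map D.geom.embK := Subgroup.mem_map_of_mem _ h
    rw [D.geom.embK_PiX] at this
    exact this.1

/-- The homomorphism `Π_{C_K} → Π_{C_F} × Gal(Ω/k)`, `y ↦ (embK y, 1)` (on `Δ_{C_K}` it lands in `Π_{C_v̲}`: the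
injection "`Δ_C → Π_{C_v̲}`" of the cartesian diagram of Def. 3.1 (e)). [claim: Mochizuki2012, status: disputed] -/
def embLoc : D.geom.pe.PiC →* D.PiC × (Ω ≃ₐ[k] Ω) := (MonoidHom.inl D.PiC (Ω ≃ₐ[k] Ω)).comp D.geom.embK

omit [IsScalarTower F K Fbar] [Normal K Fbar] [Algebra.IsIntegral F Fbar] [Algebra K Ω] [Algebra K k]
  [IsScalarTower K k Ω] [IsGalois k Ω] in
/-- Values of `embLoc`. [claim: Mochizuki2012, status: disputed] -/
@[simp] theorem embLoc_apply (y : D.geom.pe.PiC) : D.embLoc k y = (D.geom.embK y, (1 : Ω ≃ₐ[k] Ω)) := rfl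

omit [IsScalarTower F K Fbar] [Normal K Fbar] [Algebra.IsIntegral F Fbar] [Algebra K Ω] [Algebra K k]
  [IsScalarTower K k Ω] [IsGalois k Ω] in
/-- `embLoc` is continuous. [claim: Mochizuki2012, status: disputed] -/
theorem continuous_embLoc : Continuous (D.embLoc (Ω := Ω) k) :=
  D.geom.embK_continuous.prodMk continuous_const

omit [Algebra.IsIntegral F Fbar] [IsGalois k Ω] in
/-- `embLoc` maps `Δ_{C_K}` into `Π_{C_v̲}`. [claim: Mochizuki2012, status: disputed] -/
theorem embLoc_mem_PiLoc {y : D.geom.pe.PiC} (hy : y ∈ D.geom.pe.E.geom) :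
    D.embLoc k y ∈ D.PiLoc D.PiCK (localToGF F k ι) := by
  refine (D.mem_PiLoc _ _ _).mpr ⟨⟨y, rfl⟩, ?_⟩
  change D.augGF (D.geom.embK y) = localToGF F k ι 1
  rw [map_one, D.augGF_eq_one_iff]
  exact (D.embK_mem_deltaC_iff y).mpr hy

/-! ### Condition (∗) for the base change -/

/-- Transport of the (∗)-subgroup `(⁅A, A⁆ ⊔ ⟨A^n⟩)‾ ≤ G` along a continuous homomorphism `φ : G → G'` carrying `A`
into a subgroup `A'` of a CLOSED subgroup `P ≤ G'`: the image of every element of `(⁅A, A⁆ ⊔ ⟨A^n⟩)‾` is (the value of)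
an element of `(⁅A', A'⁆ ⊔ ⟨A'^n⟩)‾ ≤ P` (closure minimality; the latter is closed in `G'` since `P` is).
[claim: Mochizuki2012, status: disputed] -/
theorem star_transport {G G' : Type*} [Group G] [TopologicalSpace G] [IsTopologicalGroup G] [Group G']
    [TopologicalSpace G'] [IsTopologicalGroup G'] (n : ℕ) (A : Subgroup G) (P : Subgroup G')
    (hP : IsClosed (P : Set G')) (A' : Subgroup P) (φ : G →* G') (hφ : Continuous φ)
    (hA : ∀ a ∈ A, ∃ ha : φ a ∈ P, (⟨φ a, ha⟩ : P) ∈ A') {c : G}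
    (hc : c ∈ (⁅A, A⁆ ⊔ Subgroup.closure ((fun y : G => y ^ n) '' (A : Set G))).topologicalClosure) :
    ∃ s ∈ (⁅A', A'⁆ ⊔ Subgroup.closure ((fun y : P => y ^ n) '' (A' : Set P))).topologicalClosure,
      (s : G') = φ c := by
  have hemb : IsClosedEmbedding (fun x : P => (x : G')) := hP.isClosedEmbedding_subtypeVal
  have hS : IsClosed ((((⁅A', A'⁆ ⊔ Subgroup.closure ((fun y : P => y ^ n) '' (A' : Set P))).topologicalClosure).map
      P.subtype : Subgroup G') : Set G') := by
    rw [Subgroup.coe_map]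
    exact hemb.isClosedMap _ (Subgroup.isClosed_topologicalClosure _)
  have key : (⁅A, A⁆ ⊔ Subgroup.closure ((fun y : G => y ^ n) '' (A : Set G))).topologicalClosure ≤
      (((⁅A', A'⁆ ⊔ Subgroup.closure ((fun y : P => y ^ n) '' (A' : Set P))).topologicalClosure).map
        P.subtype).comap φ := by
    refine Subgroup.topologicalClosure_minimal _ ?_ (hS.preimage hφ)
    refine sup_le ?_ ?_
    · rw [Subgroup.commutator_le]
      intro a ha b hb
      obtain ⟨ha', haA⟩ := hA a ha
      obtain ⟨hb', hbA⟩ := hA b hb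
      refine ⟨⟨φ a, ha'⟩ * ⟨φ b, hb'⟩ * ⟨φ a, ha'⟩⁻¹ * ⟨φ b, hb'⟩⁻¹, Subgroup.le_topologicalClosure _
        (Subgroup.mem_sup_left (Subgroup.commutator_mem_commutator haA hbA)), ?_⟩
      simp only [commutatorElement_def, map_mul, map_inv, Subgroup.coe_subtype]
    · rw [Subgroup.closure_le]
      rintro _ ⟨a, ha, rfl⟩
      obtain ⟨ha', haA⟩ := hA a ha
      refine ⟨⟨φ a, ha'⟩ ^ n, Subgroup.le_topologicalClosure _
        (Subgroup.mem_sup_right (Subgroup.subset_closure ⟨_, haA, rfl⟩)), ?_⟩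
      simp only [map_pow, Subgroup.coe_subtype]
  obtain ⟨s, hs, hse⟩ := key hc
  exact ⟨s, hs, hse⟩

omit [IsGalois k Ω] in
/-- **Condition (∗) for the base change**: for `g ∈ Π_{X_v̲}` and `x ∈ Π_{X_v̲} ∩ Δ_{v̲}` the commutator `g x g⁻¹ x⁻¹`
lies in `(⁅Δ_{X,v̲}, Δ_{X,v̲}⁆ · Δ_{X,v̲}^l)‾` — transported from the (∗) of the `K`-level datum (`pe.star`) along
`y ↦ (embK y, 1)`: `g = (embK y_g, σ)`, `x = (embK y_x, 1)` with `y_g ∈ Π_X`, `y_x ∈ Π_X ∩ Δ_{C_K}`.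
[claim: Mochizuki2012, status: disputed] -/
theorem starLoc (g : D.PiLoc D.PiCK (localToGF F k ι))
    (hg : g ∈ D.geom.PiX.comap (D.fstLoc D.PiCK (localToGF F k ι)))
    (x : D.PiLoc D.PiCK (localToGF F k ι))
    (hx : x ∈ D.geom.PiX.comap (D.fstLoc D.PiCK (localToGF F k ι)) ⊓ (D.augLoc D.PiCK (localToGF F k ι)).ker) :
    g * x * g⁻¹ * x⁻¹ ∈
      (⁅D.geom.PiX.comap (D.fstLoc D.PiCK (localToGF F k ι)) ⊓ (D.augLoc D.PiCK (localToGF F k ι)).ker,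
          D.geom.PiX.comap (D.fstLoc D.PiCK (localToGF F k ι)) ⊓ (D.augLoc D.PiCK (localToGF F k ι)).ker⁆ ⊔
        Subgroup.closure ((fun y : D.PiLoc D.PiCK (localToGF F k ι) => y ^ D.geom.pe.l) ''
          ((D.geom.PiX.comap (D.fstLoc D.PiCK (localToGF F k ι)) ⊓ (D.augLoc D.PiCK (localToGF F k ι)).ker :
            Subgroup (D.PiLoc D.PiCK (localToGF F k ι))) :
            Set (D.PiLoc D.PiCK (localToGF F k ι))))).topologicalClosure := by
  -- unpack `g`, `x`
  obtain ⟨hxX, hxΔ⟩ := Subgroup.mem_inf.mp hx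
  have hx2 : x.1.2 = 1 := (D.mem_ker_augLoc _ _ x).mp hxΔ
  obtain ⟨yg, hyg⟩ := ((D.mem_PiLoc _ _ _).mp g.2).1
  obtain ⟨yx, hyx⟩ := ((D.mem_PiLoc _ _ _).mp x.2).1
  have hygX : yg ∈ D.geom.pe.PiX :=
    (D.embK_mem_PiX_iff yg).mp (by rw [hyg]; exact Subgroup.mem_comap.mp hg)
  have hyxX : yx ∈ D.geom.pe.PiX :=
    (D.embK_mem_PiX_iff yx).mp (by rw [hyx]; exact Subgroup.mem_comap.mp hxX)
  have hyxΔ : yx ∈ D.geom.pe.E.geom := by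
    rw [← D.embK_mem_deltaC_iff, hyx, ← D.augGF_eq_one_iff, ((D.mem_PiLoc _ _ _).mp x.2).2, hx2, map_one]
  -- the `K`-level (∗), transported
  have hstar := D.geom.pe.star yg hygX yx (Subgroup.mem_inf.mpr ⟨hyxX, hyxΔ⟩)
  have hA : ∀ a ∈ D.geom.pe.PiX ⊓ D.geom.pe.E.geom, ∃ ha : D.embLoc k a ∈ D.PiLoc D.PiCK (localToGF F k ι),
      (⟨D.embLoc k a, ha⟩ : D.PiLoc D.PiCK (localToGF F k ι)) ∈
        D.geom.PiX.comap (D.fstLoc D.PiCK (localToGF F k ι)) ⊓ (D.augLoc D.PiCK (localToGF F k ι)).ker := by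
    intro a ha
    obtain ⟨haX, haΔ⟩ := Subgroup.mem_inf.mp ha
    exact ⟨D.embLoc_mem_PiLoc k ι haΔ,
      Subgroup.mem_inf.mpr ⟨(D.embK_mem_PiX_iff a).mpr haX, (D.mem_ker_augLoc _ _ _).mpr rfl⟩⟩
  obtain ⟨s, hs, hse⟩ := star_transport D.geom.pe.l _ (D.PiLoc D.PiCK (localToGF F k ι))
    (D.isClosed_PiLoc_of_isClosed D.PiCK _ (D.PiCK.isClosed_of_isOpen D.isOpen_PiCK) (continuous_localToGF F k ι)) _
    (D.embLoc k) (D.continuous_embLoc k) hA hstar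
  -- the commutator upstairs is the image of the commutator downstairs
  have hgx : ((g * x * g⁻¹ * x⁻¹ : D.PiLoc D.PiCK (localToGF F k ι)) : D.PiC × (Ω ≃ₐ[k] Ω)) =
      D.embLoc k (yg * yx * yg⁻¹ * yx⁻¹) := by
    rw [map_mul, map_mul, map_mul, map_inv, map_inv, embLoc_apply, embLoc_apply, hyg, hyx]
    refine Prod.ext rfl ?_
    change g.1.2 * x.1.2 * (g.1.2)⁻¹ * (x.1.2)⁻¹ = 1 * 1 * 1⁻¹ * 1⁻¹
    simp [hx2]
  have : (g * x * g⁻¹ * x⁻¹ : D.PiLoc D.PiCK (localToGF F k ι)) = s := Subtype.ext (hgx.trans hse.symm)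
  rw [this]
  exact hs

/-- **`Π_{X_v̲} ↠ Gal(Ω/k)`** (the base change of `X_K` is geometrically connected: `Π_{X̲_K} ↠ G_K`).
[claim: Mochizuki2012, status: disputed] -/
theorem aug_piXLoc_surjective :
    Function.Surjective ((D.extLoc k ι).aug.toMonoidHom.comp
      (D.geom.PiX.comap (D.fstLoc D.PiCK (localToGF F k ι))).subtype) := by
  intro σ
  obtain ⟨x, hx, hxσ⟩ := D.galoisSubgroupOf_le_map_of_PiXund_le D.PiXund_le_PiXK (localToGF_mem F k ι σ)
  obtain ⟨hxX, hxC⟩ := Subgroup.mem_inf.mp hx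
  exact ⟨⟨⟨(x, σ), (D.mem_PiLoc _ _ _).mpr ⟨hxC, hxσ⟩⟩, hxX⟩, rfl⟩

/-- **`Π_{C̲_v̲} ↠ Gal(Ω/k)`** (`Π_{C̲_K} ⊇ Π_{X̲_K} ↠ G_K`). [claim: Mochizuki2012, status: disputed] -/
theorem aug_piCbarLoc_surjective :
    Function.Surjective ((D.extLoc k ι).aug.toMonoidHom.comp
      (D.PiCund.comap (D.fstLoc D.PiCK (localToGF F k ι))).subtype) := by
  intro σ
  obtain ⟨x, hx, hxσ⟩ := D.galoisSubgroupOf_le_map_of_PiXund_le D.PiXund_le_PiCund (localToGF_mem F k ι σ)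
  have hxC : x ∈ D.PiCK := Subgroup.map_le_range _ _ hx
  exact ⟨⟨⟨(x, σ), (D.mem_PiLoc _ _ _).mpr ⟨hxC, hxσ⟩⟩, hx⟩, rfl⟩

/-- **The cusp `2ε̲` of `X̲_v̲` is `k`-rational: `D_{2ε,v̲} ↠ Gal(Ω/k)`** (from `D_{2ε} ↠ G_K`, field `aug_decomp_twoε`).
[claim: Mochizuki2012, status: disputed] -/
theorem aug_decompLoc_twoε_surjective :
    Function.Surjective ((D.extLoc k ι).aug.toMonoidHom.comp
      (((D.geom.pe.decomp D.geom.pe.twoε).map D.geom.embK).comap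
        (D.fstLoc D.PiCK (localToGF F k ι))).subtype) := by
  intro σ
  obtain ⟨y, hy⟩ := D.geom.pe.aug_decomp_twoε
    (D.geom.galKIso.symm ⟨localToGF F k ι σ, localToGF_mem F k ι σ⟩)
  have hxσ : D.augGF (D.geom.embK y) = localToGF F k ι σ := by
    rw [augGF_apply, D.geom.aug_compat]
    change ((D.geom.galKIso ((D.geom.pe.E.aug.toMonoidHom.comp (D.geom.pe.decomp D.geom.pe.twoε).subtype) y) :
      galoisSubgroupOf F K Fbar) : Fbar ≃ₐ[F] Fbar) = _
    rw [hy, MulEquiv.apply_symm_apply]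
  exact ⟨⟨⟨(D.geom.embK y, σ), (D.mem_PiLoc _ _ _).mpr ⟨⟨y, rfl⟩, hxσ⟩⟩,
    Subgroup.mem_map_of_mem _ y.2⟩, rfl⟩

/-! ### The local §1 datum -/

/-- **[IUTchI] Def. 3.1 (e): the §1 data of the local core `C_v̲ := C_K ×_K K_v̲`** as a `PuncturedEllipticData` over
`Gal(Ω/k)` (`k = K_v̲`, `Ω = K̄_v̲`): `Π_{C_v̲} := Π_{C_K} ×_{G_F} Gal(Ω/k)` (`extLoc`), `Π_{X_v̲}`, `Π_{C̲_v̲}` the preimages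
of `Π_{X_F}`, `Π_{C̲_K}` under `Π_{C_v̲} → Π_{C_F}`, the same cusps with local decomposition groups `D_{x,v̲} :=` the
preimage of `embK(D_x)`, the same `ε⁰, ε′, ε″, 2ε̲` ("`ε̲_v` for the cusp of `C̲_v` determined by `ε̲`") and the same
`l`; ALL standing conditions of §1 PROVED for the base change. [claim: Mochizuki2012, status: disputed] -/
def peLoc : PuncturedEllipticData.{w} where
  l := D.geom.pe.l
  five_le := D.geom.pe.five_le
  coprime_six := D.geom.pe.coprime_six
  E := D.extLoc k ι
  PiX := D.geom.PiX.comap (D.fstLoc D.PiCK (localToGF F k ι))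
  PiCbar := D.PiCund.comap (D.fstLoc D.PiCK (localToGF F k ι))
  isOpen_piX := D.geom.PiX_isOpen.preimage (D.continuous_fstLoc D.PiCK (localToGF F k ι))
  isOpen_piCbar := D.isOpen_PiCund.preimage (D.continuous_fstLoc D.PiCK (localToGF F k ι))
  index_piX := D.index_piXLoc k ι
  aug_piX := D.aug_piXLoc_surjective k ι
  aug_piCbar := D.aug_piCbarLoc_surjective k ι
  star := fun g hg x hx => D.starLoc k ι g hg x hx
  Cusp := D.geom.pe.Cusp
  decomp := fun c => ((D.geom.pe.decomp c).map D.geom.embK).comap (D.fstLoc D.PiCK (localToGF F k ι))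
  decomp_le := fun c => by
    change ((D.geom.pe.decomp c).map D.geom.embK).comap (D.fstLoc D.PiCK (localToGF F k ι)) ≤
      D.geom.PiX.comap (D.fstLoc D.PiCK (localToGF F k ι)) ⊓ D.PiCund.comap (D.fstLoc D.PiCK (localToGF F k ι))
    rw [← Subgroup.comap_inf]
    refine Subgroup.comap_mono (f := D.fstLoc D.PiCK (localToGF F k ι)) ?_
    refine (Subgroup.map_mono (f := D.geom.embK) (D.geom.pe.decomp_le c)).trans (le_inf ?_ ?_)
    · refine (Subgroup.map_mono (f := D.geom.embK) inf_le_left).trans ?_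
      rw [D.geom.embK_PiX]
      exact inf_le_left
    · exact Subgroup.map_mono (f := D.geom.embK) inf_le_right
  ε0 := D.geom.pe.ε0
  ε1 := D.geom.pe.ε1
  ε2 := D.geom.pe.ε2
  twoε := D.geom.pe.twoε
  ε1_ne_ε0 := D.geom.pe.ε1_ne_ε0
  ε2_ne_ε0 := D.geom.pe.ε2_ne_ε0
  ε1_ne_ε2 := D.geom.pe.ε1_ne_ε2
  twoε_ne := D.geom.pe.twoε_ne
  aug_decomp_twoε := D.aug_decompLoc_twoε_surjective k ι

/-- `Π_{C_v̲} ↠ Gal(Ω/k)` of the local datum IS `extLoc` (the base change `PiLoc PiCK`).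
[claim: Mochizuki2012, status: disputed] -/
theorem peLoc_E : (D.peLoc k ι).E = D.extLoc k ι := rfl

/-- `Π_{X_v̲}` of the local datum IS the preimage of `Π_{X_F}` under `Π_{C_v̲} → Π_{C_F}`.
[claim: Mochizuki2012, status: disputed] -/
theorem peLoc_PiX : (D.peLoc k ι).PiX = D.geom.PiX.comap (D.fstLoc D.PiCK (localToGF F k ι)) := rfl

/-- `Π_{C̲_v̲}` of the local datum IS the preimage of `Π_{C̲_K}`. [claim: Mochizuki2012, status: disputed] -/
theorem peLoc_PiCbar : (D.peLoc k ι).PiCbar = D.PiCund.comap (D.fstLoc D.PiCK (localToGF F k ι)) := rfl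

/-- The cusps of the local datum ARE the cusps of the global one ("`ε̲_v` … determined by `ε̲`"), with local
decomposition groups the preimages of the global ones. [claim: Mochizuki2012, status: disputed] -/
theorem peLoc_decomp (c : D.geom.pe.Cusp) : (D.peLoc k ι).decomp c =
    ((D.geom.pe.decomp c).map D.geom.embK).comap (D.fstLoc D.PiCK (localToGF F k ι)) := rfl

end PeLoc

end InitialThetaData

end Literature.IUT.HodgeTheaters

end
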